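import Summits.AtomisticToContinuum.HydrodynamicLimit.Theorems.AntiMazurCoboundariesCorrectorPressureDecayKiferWallGibbsSanity

/-!
# The single-site DLR activity bound for dilute hard-sphere Gibbs states

Crux stmt-AtomisticToContinuum-14135 `AntiMazurCoboundaries.CorrectorPressureDecay` ("X"), line `FirstLemma` (idea
`kifer-compactification`), namespace `…Theorems.KiferCompactification`; registered stub `stub_activityBound` of skeleton v9:
a translation-invariant unit-diameter hard-sphere Gibbs state `G` (`IsHardSphereGibbs 1 z θ⁻¹ u₀ G`, Maxwellian marks) of
density `ρ ≤ 1/128` has activity `z ≤ 2ρ` (the `k ≤ 1` part of the GNZ / DLR identity `ρ = z · G{origin insertable}`,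
Ruelle 1969 §4.2). Route (unit cube `Λ = [0,1)³`, occupation event `A = {N_{Λ × ℝ³} ≠ 0}`):

* UPPER (Markov): `G A ≤ E_G[N_{Λ × ℝ³}] = density G = ρ` (`measure_count_ne_zero_le_lintegral`);
* LOWER (DLR): `G A = ∫ γ_Λ(A | Y) dG(Y)`, and for a boundary condition `Y` with no particle above the guard box `[-1,2)³`
  every single particle thrown into `Λ` is hard-core compatible, so the `k = 1` term gives `weight(A | Y) ≥ z`
  (`ofReal_le_gibbsWeight_occupied`), while `weight(univ | Y) ≤ 1 + weight(A | Y)` always, since a.s. a thrown particle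
  occupies `Λ` (`gibbsWeight_univ_le_one_add`); hence `γ_Λ(A | Y) ≥ z / (1 + z)` (`ofReal_div_le_gibbsSpec_occupied`), and
  `G{Y has a particle above [-1,2)³} ≤ 27 ρ` by Markov, subadditivity over the `27` unit cubes covering the guard box and
  translation invariance (`measure_guardOccupied_le`);
* so `ρ ≥ (z/(1+z)) (1 - 27ρ)`, i.e. `z (1 - 28ρ) ≤ ρ`, whence `z ≤ 2ρ` for `ρ ≤ 1/128`.
-/

noncomputable section

open MeasureTheory ProbabilityTheory Set Filter Topology Function
open scoped ENNReal

namespace Summit.AtomisticToContinuum.HydrodynamicLimit.Theorems.KiferCompactification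

open Literature.MathematicalPhysics.KineticTheory (T3 V3 gaussMeasure)
open Literature.Analysis.FluidPDE (IsHardSphereGibbs IsTranslationInvariant HardCoreIn superposeIn maxwellPhaseMeasure
  gibbsWeight gibbsSpec)
open Literature.Analysis.FunctionSpaces (PointConfig)
open Literature.Analysis.FunctionSpaces.Torus (unitCube measurableSet_unitCube)

section ActivityBound

/-! ## Occupation events and Markov's inequality for counts -/

/-- Occupation events `{X | N_s(X) ≠ 0}` of measurable sets are measurable. -/
theorem measurableSet_count_ne_zero {s : Set (V3 × V3)} (hs : MeasurableSet s) :
    MeasurableSet {X : PointConfig (V3 × V3) | X.count s ≠ 0} :=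
  (PointConfig.measurable_count hs) (MeasurableSpace.measurableSet_top : MeasurableSet {n : ℕ∞ | n ≠ 0})

/-- A nonzero count is `≥ 1` (in `ℝ≥0∞`). -/
theorem one_le_toENNReal_count {s : Set (V3 × V3)} {X : PointConfig (V3 × V3)} (hX : X.count s ≠ 0) :
    (1 : ℝ≥0∞) ≤ ((X.count s : ℕ∞) : ℝ≥0∞) := by
  rw [← ENat.toENNReal_one, ENat.toENNReal_le]
  exact Order.one_le_iff_ne_zero.2 hX

/-- **Markov for counts**: `μ{N_s ≠ 0} ≤ E_μ[N_s]`. -/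
theorem measure_count_ne_zero_le_lintegral (μ : Measure (PointConfig (V3 × V3))) {s : Set (V3 × V3)}
    (hs : MeasurableSet s) : μ {X | X.count s ≠ 0} ≤ ∫⁻ X, ((X.count s : ℕ∞) : ℝ≥0∞) ∂μ := by
  rw [← lintegral_indicator_one (measurableSet_count_ne_zero hs)]
  refine lintegral_mono fun X => ?_
  by_cases hX : X ∈ {X : PointConfig (V3 × V3) | X.count s ≠ 0}
  · rw [indicator_of_mem hX, Pi.one_apply]
    exact one_le_toENNReal_count hX
  · rw [indicator_of_notMem hX]
    exact zero_le

/-! ## The guard box `[-1, 2)³` and its covering by `27` unit cubes -/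

/-- The guard box `[-1, 2)³` is measurable. -/
theorem measurableSet_guardBox : MeasurableSet {q : V3 | ∀ i, q i ∈ Ico (-1 : ℝ) 2} := by
  have : {q : V3 | ∀ i, q i ∈ Ico (-1 : ℝ) 2} = ⋂ i, (fun y : V3 => y i) ⁻¹' Ico (-1) 2 := by
    ext y
    simp
  rw [this]
  exact MeasurableSet.iInter fun i => measurableSet_Ico.preimage (by fun_prop)

/-- A point of the unit cube `[0,1)³` and a point outside the guard box `[-1,2)³` are at Euclidean distance `≥ 1` (some
coordinate differs by `≥ 1`). -/
theorem one_le_norm_sub_of_not_mem_guardBox {p q : V3} (hp : p ∈ unitCube (Fin 3)) (hq : ¬ ∀ i, q i ∈ Ico (-1 : ℝ) 2) :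
    1 ≤ ‖p - q‖ := by
  simp only [not_forall, mem_Ico, not_and_or, not_le, not_lt] at hq
  obtain ⟨i, hi⟩ := hq
  have hpi := hp i
  have h1 : 1 ≤ |p i - q i| := by
    rcases hi with hi | hi
    · rw [abs_of_nonneg (by linarith [hpi.1])]
      linarith [hpi.1]
    · rw [abs_of_nonpos (by linarith [hpi.2])]
      linarith [hpi.2]
  have h2 : |p i - q i| ≤ ‖p - q‖ := by
    have := PiLp.norm_apply_le (p - q) i
    simpa [Real.norm_eq_abs] using this
  exact h1.trans h2

/-- The translates `a + [0,1)³` of the unit cube are measurable. -/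
theorem measurableSet_sub_mem_unitCube (a : V3) : MeasurableSet {q : V3 | q - a ∈ unitCube (Fin 3)} :=
  measurableSet_unitCube.preimage (measurable_id.sub measurable_const)

/-- Translating `a + [0,1)³` back by `a` gives the unit cube. -/
theorem preimage_add_sub_mem_unitCube (a : V3) : (· + a) ⁻¹' {q : V3 | q - a ∈ unitCube (Fin 3)} = unitCube (Fin 3) := by
  ext q
  simp

/-- **The guard box is covered by the `27` integer translates `(e - 1) + [0,1)³`, `e ∈ {0,1,2}³`, of the unit cube.** -/
theorem guardBox_subset_iUnion : {q : V3 | ∀ i, q i ∈ Ico (-1 : ℝ) 2} ⊆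
    ⋃ e : Fin 3 → Fin 3, {q : V3 | q - (WithLp.toLp 2 fun i => ((e i : ℕ) : ℝ) - 1) ∈ unitCube (Fin 3)} := by
  intro q hq
  simp only [mem_setOf_eq, mem_Ico] at hq
  have hfl : ∀ i, ⌊q i + 1⌋₊ < 3 := fun i =>
    (Nat.floor_lt (by linarith [(hq i).1])).2 (by push_cast; linarith [(hq i).2])
  refine mem_iUnion.2 ⟨fun i => ⟨⌊q i + 1⌋₊, hfl i⟩, ?_⟩
  simp only [mem_setOf_eq, Literature.Analysis.FunctionSpaces.Torus.mem_unitCube, mem_Ico]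
  intro i
  have h0 : 0 ≤ q i + 1 := by linarith [(hq i).1]
  have h1 := Nat.floor_le h0
  have h2 := Nat.lt_floor_add_one (q i + 1)
  constructor
  · simp only [PiLp.sub_apply]
    linarith
  · simp only [PiLp.sub_apply]
    linarith

/-! ## Translation invariance of the intensity -/

/-- Under a translation-invariant law, the mean numbers of particles above `S - a` and above `S` coincide. -/
theorem lintegral_count_preimage_add_eq {G : Measure (PointConfig (V3 × V3))} (hT : IsTranslationInvariant G)
    {S : Set V3} (hS : MeasurableSet S) (a : V3) :
    ∫⁻ ω, ((ω.count (Prod.fst ⁻¹' ((· + a) ⁻¹' S)) : ℕ∞) : ℝ≥0∞) ∂G =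
      ∫⁻ ω, ((ω.count (Prod.fst ⁻¹' S) : ℕ∞) : ℝ≥0∞) ∂G := by
  conv_rhs => rw [← hT a]
  rw [lintegral_map (Literature.MathematicalPhysics.KineticTheory.PointProcess.measurable_count_window hS)
    (PointConfig.measurable_translate _)]
  refine lintegral_congr fun ω => ?_
  rw [PointConfig.count_translate]
  rfl

/-- **Few boundary conditions have a particle above the guard box**: `G{N_{[-1,2)³ × ℝ³} ≠ 0} ≤ 27 · density G` for a
translation-invariant law `G` (Markov, subadditivity over the `27` covering cubes, translation invariance). -/
theorem measure_guardOccupied_le {G : Measure (PointConfig (V3 × V3))} (hT : IsTranslationInvariant G) :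
    G {Y | Y.count (Prod.fst ⁻¹' {q : V3 | ∀ i, q i ∈ Ico (-1 : ℝ) 2}) ≠ 0} ≤
      27 * Literature.MathematicalPhysics.KineticTheory.PointProcess.density G := by
  set B : Set V3 := {q : V3 | ∀ i, q i ∈ Ico (-1 : ℝ) 2} with hB
  set a : (Fin 3 → Fin 3) → V3 := fun e => WithLp.toLp 2 fun i => ((e i : ℕ) : ℝ) - 1 with ha
  have hBm : MeasurableSet (Prod.fst ⁻¹' B : Set (V3 × V3)) := measurableSet_guardBox.preimage measurable_fst
  have hCm : ∀ e, MeasurableSet (Prod.fst ⁻¹' {q : V3 | q - a e ∈ unitCube (Fin 3)} : Set (V3 × V3)) := fun e =>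
    (measurableSet_sub_mem_unitCube (a e)).preimage measurable_fst
  have hsub : ∀ Y : PointConfig (V3 × V3), ((Y.count (Prod.fst ⁻¹' B) : ℕ∞) : ℝ≥0∞) ≤
      ∑ e : Fin 3 → Fin 3, ((Y.count (Prod.fst ⁻¹' {q : V3 | q - a e ∈ unitCube (Fin 3)}) : ℕ∞) : ℝ≥0∞) := fun Y => by
    rw [← PointConfig.toMeasure_apply Y hBm]
    simp_rw [← PointConfig.toMeasure_apply Y (hCm _)]
    calc Y.toMeasure (Prod.fst ⁻¹' B)
        ≤ Y.toMeasure (⋃ e : Fin 3 → Fin 3, Prod.fst ⁻¹' {q : V3 | q - a e ∈ unitCube (Fin 3)}) := by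
          refine measure_mono ?_
          rw [← preimage_iUnion]
          exact preimage_mono guardBox_subset_iUnion
      _ ≤ ∑ e : Fin 3 → Fin 3, Y.toMeasure (Prod.fst ⁻¹' {q : V3 | q - a e ∈ unitCube (Fin 3)}) :=
          measure_iUnion_fintype_le _ _
  have hdens : ∀ e : Fin 3 → Fin 3,
      ∫⁻ Y, ((Y.count (Prod.fst ⁻¹' {q : V3 | q - a e ∈ unitCube (Fin 3)}) : ℕ∞) : ℝ≥0∞) ∂G =
        Literature.MathematicalPhysics.KineticTheory.PointProcess.density G := fun e => by
    rw [← lintegral_count_preimage_add_eq hT (measurableSet_sub_mem_unitCube (a e)) (a e), preimage_add_sub_mem_unitCube]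
    rfl
  calc G {Y | Y.count (Prod.fst ⁻¹' B) ≠ 0} ≤ ∫⁻ Y, ((Y.count (Prod.fst ⁻¹' B) : ℕ∞) : ℝ≥0∞) ∂G :=
        measure_count_ne_zero_le_lintegral G hBm
    _ ≤ ∫⁻ Y, ∑ e : Fin 3 → Fin 3, ((Y.count (Prod.fst ⁻¹' {q : V3 | q - a e ∈ unitCube (Fin 3)}) : ℕ∞) : ℝ≥0∞) ∂G :=
        lintegral_mono hsub
    _ = ∑ e : Fin 3 → Fin 3, ∫⁻ Y, ((Y.count (Prod.fst ⁻¹' {q : V3 | q - a e ∈ unitCube (Fin 3)}) : ℕ∞) : ℝ≥0∞) ∂G :=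
        lintegral_finsetSum _ fun e _ =>
          Literature.MathematicalPhysics.KineticTheory.PointProcess.measurable_count_window
            (measurableSet_sub_mem_unitCube (a e))
    _ = 27 * Literature.MathematicalPhysics.KineticTheory.PointProcess.density G := by
        simp_rw [hdens]
        rw [Finset.sum_const, Finset.card_univ, Fintype.card_fun, Fintype.card_fin, nsmul_eq_mul]
        norm_num

/-! ## The specification of the unit cube: a lower bound for good boundary conditions -/

/-- The grand-canonical weight is monotone in the event. -/
theorem gibbsWeight_mono (ε z β : ℝ) (u : V3) (Λ : Set V3) (Y : PointConfig (V3 × V3))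
    {A B : Set (PointConfig (V3 × V3))} (h : A ⊆ B) : gibbsWeight ε z β u Λ Y A ≤ gibbsWeight ε z β u Λ Y B := by
  haveI := sigmaFinite_maxwellPhaseMeasure β u Λ
  unfold Literature.Analysis.FluidPDE.gibbsWeight
  exact ENNReal.tsum_le_tsum fun k => mul_le_mul_right (lintegral_mono fun x =>
    indicator_le_indicator_of_subset (inter_subset_inter_left _ h) (fun _ => zero_le) _) _

/-- The a-priori law of the unit cube at `(θ⁻¹, u₀)` has mass `1`, and under its powers a.s. all thrown positions lie in
the cube and are pairwise distinct. -/
theorem ae_pi_maxwellPhaseMeasure_unitCube {θ : ℝ} (hθ : 0 < θ) (u₀ : V3) (k : ℕ) :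
    maxwellPhaseMeasure θ⁻¹ u₀ (unitCube (Fin 3)) univ = 1 ∧
      ∀ᵐ x ∂(Measure.pi fun _ : Fin k => maxwellPhaseMeasure θ⁻¹ u₀ (unitCube (Fin 3))),
        (∀ i, (x i).1 ∈ unitCube (Fin 3)) ∧ ∀ i j, (x i).1 = (x j).1 → i = j := by
  have hC₀1 : volume (unitCube (Fin 3) : Set V3) = 1 := Literature.MathematicalPhysics.StatisticalMechanics.volume_unitCube
  haveI : IsProbabilityMeasure ((volume : Measure V3).restrict (unitCube (Fin 3))) :=
    ⟨by rw [Measure.restrict_apply_univ, hC₀1]⟩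
  rw [maxwellPhaseMeasure_inv_eq_prod_gaussMeasure hθ u₀ (unitCube (Fin 3))]
  exact ⟨measure_univ, ae_pi_prod_restrict_good measurableSet_unitCube hC₀1 (gaussMeasure u₀ θ) k⟩

/-- A superposition one of whose thrown particles has its position in the window occupies the window. -/
theorem count_superposeIn_ne_zero {Λ : Set V3} {k : ℕ} {x : Fin k → V3 × V3} (i : Fin k) (hx : (x i).1 ∈ Λ)
    (Y : PointConfig (V3 × V3)) : (superposeIn Λ x Y).count (Prod.fst ⁻¹' Λ) ≠ 0 := by
  have hmem : x i ∈ (superposeIn Λ x Y).carrier ∩ Prod.fst ⁻¹' Λ :=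
    ⟨(mem_superposeIn_iff Λ x Y (x i)).2 (Or.inl ⟨⟨i, rfl⟩, hx⟩), hx⟩
  exact Set.encard_ne_zero.2 ⟨x i, hmem⟩

/-- **`weight(univ | Y) ≤ 1 + weight(A | Y)`** for the occupation event `A` of the unit cube: the `k = 0` term is `≤ 1`,
and for `k ≥ 1` a.s. a thrown particle occupies the cube. -/
theorem gibbsWeight_univ_le_one_add (z : ℝ) {θ : ℝ} (hθ : 0 < θ) (u₀ : V3) (Y : PointConfig (V3 × V3)) :
    gibbsWeight 1 z θ⁻¹ u₀ (unitCube (Fin 3)) Y univ ≤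
      1 + gibbsWeight 1 z θ⁻¹ u₀ (unitCube (Fin 3)) Y {X | X.count (Prod.fst ⁻¹' unitCube (Fin 3)) ≠ 0} := by
  haveI := sigmaFinite_maxwellPhaseMeasure θ⁻¹ u₀ (unitCube (Fin 3))
  set C₀ : Set V3 := unitCube (Fin 3) with hC₀
  unfold Literature.Analysis.FluidPDE.gibbsWeight
  rw [ENNReal.tsum_eq_add_tsum_ite 0]
  refine add_le_add ?_ (ENNReal.tsum_le_tsum fun k => ?_)
  · rw [pow_zero, Nat.factorial_zero, Nat.cast_one, div_one, ENNReal.ofReal_one, one_mul]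
    calc ∫⁻ x : Fin 0 → V3 × V3, (univ ∩ {X | HardCoreIn 1 C₀ X}).indicator 1 (superposeIn C₀ x Y)
          ∂(Measure.pi fun _ : Fin 0 => maxwellPhaseMeasure θ⁻¹ u₀ C₀)
        ≤ ∫⁻ _ : Fin 0 → V3 × V3, 1 ∂(Measure.pi fun _ : Fin 0 => maxwellPhaseMeasure θ⁻¹ u₀ C₀) :=
          lintegral_mono fun x => indicator_le_self _ _ _
      _ = 1 := by rw [lintegral_one, Measure.pi_univ, Finset.univ_eq_empty, Finset.prod_empty]
  · split_ifs with hk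
    · exact zero_le
    · refine mul_le_mul_right (lintegral_mono_ae ?_) _
      filter_upwards [(ae_pi_maxwellPhaseMeasure_unitCube hθ u₀ k).2] with x hx
      by_cases hH : HardCoreIn 1 C₀ (superposeIn C₀ x Y)
      · have h1 : superposeIn C₀ x Y ∈ univ ∩ {X | HardCoreIn 1 C₀ X} := ⟨mem_univ _, hH⟩
        have h2 : superposeIn C₀ x Y ∈ {X : PointConfig (V3 × V3) | X.count (Prod.fst ⁻¹' C₀) ≠ 0} ∩
            {X | HardCoreIn 1 C₀ X} :=
          ⟨count_superposeIn_ne_zero (⟨0, Nat.pos_of_ne_zero hk⟩ : Fin k) (hx.1 _) Y, hH⟩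
        rw [indicator_of_mem h1, indicator_of_mem h2]
      · rw [indicator_of_notMem (fun h => hH h.2)]
        exact zero_le

/-- **`z ≤ weight(A | Y)` for good boundary conditions**: if `Y` has no particle above the guard box, every single
particle thrown into the unit cube is hard-core compatible, so the `k = 1` term of the weight of the occupation event is
`z`. -/
theorem ofReal_le_gibbsWeight_occupied {z θ : ℝ} (hθ : 0 < θ) (u₀ : V3) {Y : PointConfig (V3 × V3)}
    (hY : Y.count (Prod.fst ⁻¹' {q : V3 | ∀ i, q i ∈ Ico (-1 : ℝ) 2}) = 0) :
    ENNReal.ofReal z ≤ gibbsWeight 1 z θ⁻¹ u₀ (unitCube (Fin 3)) Y {X | X.count (Prod.fst ⁻¹' unitCube (Fin 3)) ≠ 0} := by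
  haveI := sigmaFinite_maxwellPhaseMeasure θ⁻¹ u₀ (unitCube (Fin 3))
  set C₀ : Set V3 := unitCube (Fin 3) with hC₀
  have hYB : ∀ q ∈ Y, ¬ ∀ i, q.1 i ∈ Ico (-1 : ℝ) 2 := fun q hq hqB =>
    (Set.eq_empty_iff_forall_notMem.1 (Set.encard_eq_zero.1 hY)) q ⟨hq, hqB⟩
  unfold Literature.Analysis.FluidPDE.gibbsWeight
  refine le_trans ?_ (ENNReal.le_tsum 1)
  rw [pow_one, Nat.factorial_one, Nat.cast_one, div_one]
  have hint : ∫⁻ x : Fin 1 → V3 × V3, ({X : PointConfig (V3 × V3) | X.count (Prod.fst ⁻¹' C₀) ≠ 0} ∩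
      {X | HardCoreIn 1 C₀ X}).indicator 1 (superposeIn C₀ x Y) ∂(Measure.pi fun _ : Fin 1 => maxwellPhaseMeasure θ⁻¹ u₀ C₀) = 1 := by
    have hae : ∀ᵐ x : Fin 1 → V3 × V3 ∂(Measure.pi fun _ : Fin 1 => maxwellPhaseMeasure θ⁻¹ u₀ C₀),
        ({X : PointConfig (V3 × V3) | X.count (Prod.fst ⁻¹' C₀) ≠ 0} ∩ {X | HardCoreIn 1 C₀ X}).indicator
          (1 : PointConfig (V3 × V3) → ℝ≥0∞) (superposeIn C₀ x Y) = 1 := by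
      filter_upwards [(ae_pi_maxwellPhaseMeasure_unitCube hθ u₀ 1).2] with x hx
      have hH : HardCoreIn 1 C₀ (superposeIn C₀ x Y) := by
        rw [hardCoreIn_superposeIn_iff 1 C₀ hx.1 hx.2 Y]
        exact ⟨fun i j hij => absurd (Subsingleton.elim i j) hij,
          fun i q hq _ => one_le_norm_sub_of_not_mem_guardBox (hx.1 i) (hYB q hq)⟩
      have hmem : superposeIn C₀ x Y ∈ {X : PointConfig (V3 × V3) | X.count (Prod.fst ⁻¹' C₀) ≠ 0} ∩
          {X | HardCoreIn 1 C₀ X} :=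
        ⟨count_superposeIn_ne_zero 0 (hx.1 0) Y, hH⟩
      rw [indicator_of_mem hmem, Pi.one_apply]
    rw [lintegral_congr_ae hae, lintegral_one, Measure.pi_univ, Finset.prod_const, Finset.card_univ, Fintype.card_fin,
      pow_one, (ae_pi_maxwellPhaseMeasure_unitCube hθ u₀ 0).1]
  rw [hint, mul_one]

/-- **The single-site DLR lower bound**: for a good boundary condition with finite normalising weight,
`γ_{[0,1)³}(A | Y) ≥ z / (1 + z)`. -/
theorem ofReal_div_le_gibbsSpec_occupied {z θ : ℝ} (hz : 0 < z) (hθ : 0 < θ) (u₀ : V3) {Y : PointConfig (V3 × V3)}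
    (hY : Y.count (Prod.fst ⁻¹' {q : V3 | ∀ i, q i ∈ Ico (-1 : ℝ) 2}) = 0)
    (hfin : gibbsWeight 1 z θ⁻¹ u₀ (unitCube (Fin 3)) Y univ ≠ ∞) :
    ENNReal.ofReal (z / (1 + z)) ≤
      gibbsSpec 1 z θ⁻¹ u₀ (unitCube (Fin 3)) Y {X | X.count (Prod.fst ⁻¹' unitCube (Fin 3)) ≠ 0} := by
  unfold Literature.Analysis.FluidPDE.gibbsSpec
  set wA := gibbsWeight 1 z θ⁻¹ u₀ (unitCube (Fin 3)) Y {X | X.count (Prod.fst ⁻¹' unitCube (Fin 3)) ≠ 0} with hwA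
  set wU := gibbsWeight 1 z θ⁻¹ u₀ (unitCube (Fin 3)) Y univ with hwU
  have hAU : wA ≤ wU := gibbsWeight_mono 1 z θ⁻¹ u₀ _ Y (subset_univ _)
  have hU : wU ≤ 1 + wA := gibbsWeight_univ_le_one_add z hθ u₀ Y
  have hzA : ENNReal.ofReal z ≤ wA := ofReal_le_gibbsWeight_occupied hθ u₀ hY
  have hAfin : wA ≠ ∞ := ne_top_of_le_ne_top hfin hAU
  calc ENNReal.ofReal (z / (1 + z)) ≤ wA / (1 + wA) := by
        obtain ⟨b, hb0, hb⟩ : ∃ b : ℝ, 0 ≤ b ∧ wA = ENNReal.ofReal b :=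
          ⟨wA.toReal, ENNReal.toReal_nonneg, (ENNReal.ofReal_toReal hAfin).symm⟩
        rw [hb] at hzA ⊢
        have hzb : z ≤ b := (ENNReal.ofReal_le_ofReal_iff hb0).1 hzA
        rw [← ENNReal.ofReal_one, ← ENNReal.ofReal_add zero_le_one hb0, ← ENNReal.ofReal_div_of_pos (by linarith)]
        refine ENNReal.ofReal_le_ofReal ?_
        rw [div_le_div_iff₀ (by linarith) (by linarith)]
        nlinarith
    _ ≤ wA / wU := ENNReal.div_le_div_left hU _

/-! ## Assembly -/

/-- Registered stub `stub_activityBound` (line `FirstLemma`, skeleton v9): **a translation-invariant unit-diameter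
hard-sphere Gibbs state (Maxwellian marks at `(θ⁻¹, u₀)`) of density `ρ ≤ 1/128` has activity `z ≤ 2ρ`** — from the
single-site DLR bound `ρ ≥ (z/(1+z))(1 - 27ρ)`. -/
theorem stub_activityBound : ∀ (z θ : ℝ) (u₀ : V3) (G : Measure (PointConfig (V3 × V3))) (ρ : ℝ), 0 < z → 0 < θ →
    IsHardSphereGibbs 1 z θ⁻¹ u₀ G → IsTranslationInvariant G →
    Literature.MathematicalPhysics.KineticTheory.PointProcess.density G = ENNReal.ofReal ρ →
    0 ≤ ρ → ρ ≤ 1 / 128 → z ≤ 2 * ρ := by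
  intro z θ u₀ G ρ hz hθ hG hT hρG hρ0 hρ1
  haveI := hG.1
  set C₀ : Set V3 := unitCube (Fin 3) with hC₀
  have hC₀m : MeasurableSet C₀ := measurableSet_unitCube
  have hC₀b : Bornology.IsBounded C₀ := Literature.MathematicalPhysics.StatisticalMechanics.isBounded_unitCube
  set A : Set (PointConfig (V3 × V3)) := {X | X.count (Prod.fst ⁻¹' C₀) ≠ 0} with hA
  have hAm : MeasurableSet A := measurableSet_count_ne_zero (hC₀m.preimage measurable_fst)
  -- UPPER: Markov against the density
  have hU : G A ≤ ENNReal.ofReal ρ := by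
    rw [← hρG]
    exact measure_count_ne_zero_le_lintegral G (hC₀m.preimage measurable_fst)
  -- the bad boundary conditions: a particle above the guard box
  set bad : Set (PointConfig (V3 × V3)) := {Y | Y.count (Prod.fst ⁻¹' {q : V3 | ∀ i, q i ∈ Ico (-1 : ℝ) 2}) ≠ 0} with hbad
  have hbadm : MeasurableSet bad := measurableSet_count_ne_zero (measurableSet_guardBox.preimage measurable_fst)
  have hbadle : G bad ≤ ENNReal.ofReal (27 * ρ) := by
    rw [ENNReal.ofReal_mul (by norm_num), ← hρG, show ENNReal.ofReal 27 = 27 by norm_num]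
    exact measure_guardOccupied_le hT
  -- LOWER: the DLR equation in the unit cube
  have hL : ENNReal.ofReal (z / (1 + z)) * G badᶜ ≤ G A := by
    rw [hG.2 C₀ hC₀m hC₀b A hAm, ← lintegral_indicator_one hbadm.compl,
      ← lintegral_const_mul _ (measurable_one.indicator hbadm.compl)]
    refine lintegral_mono_ae ?_
    filter_upwards [ae_gibbsWeight_univ_ne_top hG hC₀m hC₀b] with Y hYfin
    by_cases hY : Y ∈ badᶜ
    · rw [indicator_of_mem hY, Pi.one_apply, mul_one]
      have hY0 : Y.count (Prod.fst ⁻¹' {q : V3 | ∀ i, q i ∈ Ico (-1 : ℝ) 2}) = 0 := by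
        simpa [hbad] using hY
      exact ofReal_div_le_gibbsSpec_occupied hz hθ u₀ hY0 hYfin
    · rw [indicator_of_notMem hY, mul_zero]
      exact zero_le
  -- pass to real numbers
  set b : ℝ := (G bad).toReal with hb
  have hGbad : G bad = ENNReal.ofReal b := (ENNReal.ofReal_toReal (measure_ne_top _ _)).symm
  have hb0 : 0 ≤ b := ENNReal.toReal_nonneg
  have hb27 : b ≤ 27 * ρ := (ENNReal.ofReal_le_ofReal_iff (by positivity)).1 (hGbad ▸ hbadle)
  have hcompl : G badᶜ = ENNReal.ofReal (1 - b) := by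
    rw [prob_compl_eq_one_sub hbadm, hGbad, ENNReal.ofReal_sub _ hb0, ENNReal.ofReal_one]
  have hmain : z / (1 + z) * (1 - b) ≤ ρ := by
    have h := hL.trans hU
    rw [hcompl, ← ENNReal.ofReal_mul (by positivity)] at h
    exact (ENNReal.ofReal_le_ofReal_iff hρ0).1 h
  have h1 : z / (1 + z) * (1 - 27 * ρ) ≤ ρ := le_trans (by gcongr) hmain
  rw [div_mul_eq_mul_div, div_le_iff₀ (by linarith)] at h1
  nlinarith

end ActivityBound

end Summit.AtomisticToContinuum.HydrodynamicLimit.Theorems.KiferCompactification
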